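import Summits.AtomisticToContinuum.HydrodynamicLimit.Theorems.InformationPercolationEngineChaosClosesEulerLocalEquilibriumFromDissipationD
import HarnessLib

/-!
# Pointwise local equilibrium from the empirical H-theorem (crux `ChaosClosesEuler`, stmt-AtomisticToContinuum-15141,
# line `empirical-h-theorem`, stub `stub_localEquilibriumFromDissipation`) — helper E: the fields along a good orbit

WHAT. The four space–time objects of the assembly, read along ONE good orbit `s ↦ Φₛz` (named definitions,
DEFINITIONALLY the `let`s `Kent`, `Kr`, `h·Y·Pred`, `R` of the statement with `bx = cone`):
* `kentW` / `krW` — the tent × cone WINDOWED entropic collision functional and its pair-energy-cut version, as functions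
  of the window centre `(t₀, x₀)`: jointly measurable and bounded (`kwindow_facts`, `kentW_facts`, `krW_facts`);
* `predField` — the Enskog integrand `h(ρ_r) Y(σ³ρ_r) 𝒫` in `(s, x)`: jointly measurable, bounded by an `(s, x)`-free
  constant (the weight vanishes where `ρ_r` is large) and NONNEGATIVE (Boltzmann's inequality, helper C);
* `rW` — its tent × cone window `R(t₀, x₀)`: jointly measurable and bounded (`PressureValueE` toolkit).
Consequently the pointwise-entropic-chaos integrand `|krW − rW|` is integrable in `x₀` and its space integral is
integrable in `t₀` on every window, so the event of `PointwiseEntropicChaos` carries information.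

References: elementary measure theory (Fubini measurability of parametric integrals). No named fact is invoked.
-/

noncomputable section

namespace Summit.AtomisticToContinuum.HydrodynamicLimit.Theorems.ChaosClosesEulerLocalEquilibriumFromDissipation

open scoped BigOperators Topology Classical MeasureTheory ENNReal InnerProductSpace
open Filter Set MeasureTheory Function
open Literature.MathematicalPhysics.KineticTheory
open Literature.Analysis.FluidPDE
open Summit.AtomisticToContinuum.HydrodynamicLimit.Theorems.LocalSecondLawNegative
open Summit.AtomisticToContinuum.HydrodynamicLimit.Theorems.LocalSecondLawLedger
open Summit.AtomisticToContinuum.HydrodynamicLimit.Theorems.ChaosClosesEulerPressureValue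
  (finite_collisionTimes_Icc integrable_tent_sub setIntegral_tent_le_one setIntegral_tent_nonneg continuous_tent_sub
    measurable_windowField abs_windowField_le integrable_slice integrableOn_integral_slice)
open Summit.AtomisticToContinuum.HydrodynamicLimit.Theorems.ChaosClosesEulerWindowedInvariance (tent_nonneg_le)
open Summit.AtomisticToContinuum.HydrodynamicLimit.Theorems.ChaosClosesEulerReduction (measurable_rhoC_orbit rhoC_le)

variable {σ : ℝ} {N : ℕ}

/-! ## §1 The objects -/

/-- **The windowed entropic collision functional** `Kent(t₀, x₀)` of the statement (tent in time × cone-localised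
entropic mark integral, normalised collision sum over `[0, τ]`). [folklore] -/
def kentW (Φ : HardSphereFlow (Torus.geometry (Fin 3)) (hsDiameter σ N) (N + 1)) (τ r δ K : ℝ) (h : ℝ → ℝ)
    (z : Phase N) (t₀ : ℝ) (x₀ : T3) : ℝ :=
  csum Φ τ (fun s i j => r⁻¹ * max (1 - |s - t₀| / r) 0 *
    markI r δ K h (Φ.flow s z) (Φ.flow s z i).1 (pvel Φ z s i j).1 (Φ.flow s z i).2 x₀) z

/-- **The pair-energy-cut windowed entropic collision functional** `Kr(t₀, x₀)` of the statement. [folklore] -/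
def krW (Φ : HardSphereFlow (Torus.geometry (Fin 3)) (hsDiameter σ N) (N + 1)) (τ r δ K L : ℝ) (h : ℝ → ℝ)
    (z : Phase N) (t₀ : ℝ) (x₀ : T3) : ℝ :=
  csum Φ τ (fun s i j => r⁻¹ * max (1 - |s - t₀| / r) 0 * cutL L (pvel Φ z s i j).1 (pvel Φ z s i j).2 *
    markI r δ K h (Φ.flow s z) (Φ.flow s z i).1 (pvel Φ z s i j).1 (Φ.flow s z i).2 x₀) z

/-- **The Enskog integrand** `h(ρ_r(x)) Y(σ³ρ_r(x)) 𝒫(Φₛz, x)` of the statement along the orbit of `z`. [folklore] -/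
def predField (Φ : HardSphereFlow (Torus.geometry (Fin 3)) (hsDiameter σ N) (N + 1)) (σ' r δ K L : ℝ) (h Y : ℝ → ℝ)
    (z : Phase N) (s : ℝ) (x : T3) : ℝ :=
  h (rhoC r (Φ.flow s z) x) * Y (σ' ^ 3 * rhoC r (Φ.flow s z) x) * PredC r δ K L (Φ.flow s z) x

/-- **The windowed Enskog prediction** `R(t₀, x₀) = σ³ ∫_{s ∈ [0,τ]} bt(s − t₀) ∫ₓ b_r(x, x₀) (h Y 𝒫)(s, x)` of the
statement. [folklore] -/
def rW (Φ : HardSphereFlow (Torus.geometry (Fin 3)) (hsDiameter σ N) (N + 1)) (σ' τ r δ K L : ℝ) (h Y : ℝ → ℝ)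
    (z : Phase N) (t₀ : ℝ) (x₀ : T3) : ℝ :=
  σ' ^ 3 * ∫ s in Set.Icc 0 τ, r⁻¹ * max (1 - |s - t₀| / r) 0 * ∫ x, cone r x x₀ * predField Φ σ' r δ K L h Y z s x

section Orbit

variable (Φ : HardSphereFlow (Torus.geometry (Fin 3)) (hsDiameter σ N) (N + 1)) {z : Phase N}

/-! ## §2 The Enskog integrand and its window -/

/-- **The Enskog integrand is jointly measurable in `(s, x)` along a good orbit** (`Y` measurable, `h` continuous).
[folklore] -/
theorem measurable_predField (hz : z ∈ Φ.good) (σ' r δ K L : ℝ) {h Y : ℝ → ℝ} (hh : Continuous h) (hY : Measurable Y) :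
    Measurable (uncurry (predField Φ σ' r δ K L h Y z)) := by
  have hγ : Measurable fun s => Φ.flow s z := (Φ.isTrajectory z hz).measurable_torus
  have hρ := measurable_rhoC_orbit hγ r
  have hP := measurable_PredC_orbit r δ K L hγ
  have h1 : Measurable fun p : ℝ × T3 => h (rhoC r (Φ.flow p.1 z) p.2) := (hh.measurable.comp hρ :)
  have h2 : Measurable fun p : ℝ × T3 => Y (σ' ^ 3 * rhoC r (Φ.flow p.1 z) p.2) := (hY.comp (measurable_const.mul hρ) :)
  have h3 : Measurable fun p : ℝ × T3 => h (rhoC r (Φ.flow p.1 z) p.2) * Y (σ' ^ 3 * rhoC r (Φ.flow p.1 z) p.2) *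
      PredC r δ K L (Φ.flow p.1 z) p.2 := ((h1.mul h2).mul hP :)
  have he : (uncurry (predField Φ σ' r δ K L h Y z)) = fun p : ℝ × T3 => h (rhoC r (Φ.flow p.1 z) p.2) *
      Y (σ' ^ 3 * rhoC r (Φ.flow p.1 z) p.2) * PredC r δ K L (Φ.flow p.1 z) p.2 := by
    funext p; rfl
  rw [he]; exact h3

/-- **The Enskog integrand is bounded by an `(s, x)`-free constant**: if `|h(a) Y(σ³a)| ≤ C_Y` and `h = 0` on `[ρ̄, ∞)`
(`ρ̄ ≥ 0`), then `|h Y 𝒫| ≤ C_Y · predBound L (A + 2 max(L,0))` (where the weight does not vanish, `ρ_r < ρ̄`). [folklore] -/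
theorem abs_predField_le {r : ℝ} (hr : 0 < r) {δ : ℝ} (hδ : 0 < δ) (σ' K L : ℝ) {h Y : ℝ → ℝ} {CY ρb : ℝ}
    (hhY : ∀ a, |h a * Y (σ' ^ 3 * a)| ≤ CY) (hh0 : ∀ a, ρb ≤ a → h a = 0) (hρb : 0 ≤ ρb) (z : Phase N) (s : ℝ)
    (x : T3) : |predField Φ σ' r δ K L h Y z s x| ≤ CY * predBound L (ALam K δ ρb + 2 * max L 0) := by
  have hCY : 0 ≤ CY := (abs_nonneg _).trans (hhY 0)
  unfold predField
  by_cases hx : h (rhoC r (Φ.flow s z) x) = 0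
  · rw [hx, zero_mul, zero_mul, abs_zero]
    have hA := ALam_add_nonneg K δ L hρb
    unfold predBound
    positivity
  · have hρ : rhoC r (Φ.flow s z) x ≤ ρb := by
      by_contra hlt; exact hx (hh0 _ (not_le.1 hlt).le)
    rw [abs_mul]
    exact mul_le_mul (hhY _) (abs_PredC_le hr hδ K L _ x hρ) (abs_nonneg _) hCY

/-- **The Enskog integrand is nonnegative** when `h(a) Y(σ³a) ≥ 0` (`𝒫 ≥ 0`, helper C). [folklore] -/
theorem predField_nonneg {r : ℝ} (hr : 0 < r) {δ : ℝ} (hδ : 0 < δ) (σ' K L : ℝ) {h Y : ℝ → ℝ}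
    (hhY0 : ∀ a, 0 ≤ h a * Y (σ' ^ 3 * a)) (z : Phase N) (s : ℝ) (x : T3) : 0 ≤ predField Φ σ' r δ K L h Y z s x :=
  mul_nonneg (hhY0 _) (PredC_nonneg hr hδ K L _ _)

/-- **The windowed Enskog prediction is jointly measurable in the window centre.** [folklore] -/
theorem measurable_rW (hz : z ∈ Φ.good) {r : ℝ} (hr : 0 < r) {δ : ℝ} (hδ : 0 < δ) (σ' τ K L : ℝ) {h Y : ℝ → ℝ}
    (hh : Continuous h) (hY : Measurable Y) {CY ρb : ℝ} (hhY : ∀ a, |h a * Y (σ' ^ 3 * a)| ≤ CY)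
    (hh0 : ∀ a, ρb ≤ a → h a = 0) (hρb : 0 ≤ ρb) : Measurable (uncurry (rW Φ σ' τ r δ K L h Y z)) := by
  have hm := (measurable_windowField hr (measurable_predField Φ hz σ' r δ K L hh hY)
    (abs_predField_le Φ hr hδ σ' K L hhY hh0 hρb z) τ).const_mul (σ' ^ 3)
  exact hm

/-- **The windowed Enskog prediction is bounded**: `|R| ≤ σ³ C_Y predBound` (`0 ≤ σ`, `0 < r < 1/2`). [folklore] -/
theorem abs_rW_le {r : ℝ} (hr : 0 < r) (hr2 : r < 1 / 2) {δ : ℝ} (hδ : 0 < δ) {σ' : ℝ} (hσ' : 0 ≤ σ') (τ K L : ℝ)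
    {h Y : ℝ → ℝ} {CY ρb : ℝ} (hhY : ∀ a, |h a * Y (σ' ^ 3 * a)| ≤ CY) (hh0 : ∀ a, ρb ≤ a → h a = 0) (hρb : 0 ≤ ρb)
    (z : Phase N) (t₀ : ℝ) (x₀ : T3) :
    |rW Φ σ' τ r δ K L h Y z t₀ x₀| ≤ σ' ^ 3 * (CY * predBound L (ALam K δ ρb + 2 * max L 0)) := by
  unfold rW
  rw [abs_mul, abs_of_nonneg (pow_nonneg hσ' 3)]
  exact mul_le_mul_of_nonneg_left (abs_windowField_le hr hr2 (abs_predField_le Φ hr hδ σ' K L hhY hh0 hρb z) τ t₀ x₀)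
    (pow_nonneg hσ' 3)

/-! ## §3 The windowed collision functionals in the window centre -/

/-- **A windowed collision sum of measurable bounded marks is jointly measurable and bounded in the window centre**
(a finite sum of products of a tent in `t₀` and a measurable bounded function of `x₀`). [folklore] -/
theorem kwindow_facts (hz : z ∈ Φ.good) (hσ : 0 < σ) {r : ℝ} (hr : 0 < r) (τ : ℝ)
    {Mk : ℝ → Fin (N + 1) → Fin (N + 1) → T3 → ℝ} (hMm : ∀ s i j, Measurable (Mk s i j))
    {B : ℝ → Fin (N + 1) → Fin (N + 1) → ℝ} (hMb : ∀ s i j x₀, |Mk s i j x₀| ≤ B s i j) :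
    Measurable (uncurry fun (t₀ : ℝ) (x₀ : T3) =>
      csum Φ τ (fun s i j => r⁻¹ * max (1 - |s - t₀| / r) 0 * Mk s i j x₀) z) ∧
    ∀ t₀ x₀, |csum Φ τ (fun s i j => r⁻¹ * max (1 - |s - t₀| / r) 0 * Mk s i j x₀) z| ≤
      csum Φ τ (fun s i j => r⁻¹ * B s i j) z := by
  -- adapted from `ChaosClosesEulerPressureValue.kwindow_measurable_bdd`
  constructor
  · have heq : (uncurry fun (t₀ : ℝ) (x₀ : T3) =>
        csum Φ τ (fun s i j => r⁻¹ * max (1 - |s - t₀| / r) 0 * Mk s i j x₀) z) =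
        fun q : ℝ × T3 => hsDiameter σ N / (N + 1 : ℝ) * ∑ s ∈ (finite_collisionTimes_Icc Φ hz τ).toFinset,
          ∑ i : Fin (N + 1), ∑ j : Fin (N + 1),
            (if i ≠ j ∧ ‖(Torus.geometry (Fin 3)).sepVec (Φ.flow s z i).1 (Φ.flow s z j).1‖ = hsDiameter σ N then
              r⁻¹ * max (1 - |s - q.1| / r) 0 * Mk s i j q.2 else 0) := by
      funext q; exact csum_eq_sum Φ hz τ _
    rw [heq]
    refine measurable_const.mul (Finset.measurable_sum _ fun s _ => Finset.measurable_sum _ fun i _ =>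
      Finset.measurable_sum _ fun j _ => ?_)
    by_cases hc : i ≠ j ∧ ‖(Torus.geometry (Fin 3)).sepVec (Φ.flow s z i).1 (Φ.flow s z j).1‖ = hsDiameter σ N
    · simp only [if_pos hc]
      have h1 : Measurable fun q : ℝ × T3 => r⁻¹ * max (1 - |s - q.1| / r) 0 :=
        (continuous_tent_sub r s).measurable.comp measurable_fst
      have h2 : Measurable fun q : ℝ × T3 => Mk s i j q.2 := (hMm s i j).comp measurable_snd
      exact h1.mul h2
    · simp only [if_neg hc]; exact measurable_const
  · intro t₀ x₀
    refine abs_csum_le Φ hz hσ fun s _ i j => ?_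
    have ht := tent_nonneg_le hr (s - t₀)
    rw [abs_mul, abs_of_nonneg ht.1]
    exact mul_le_mul ht.2 (hMb s i j x₀) (abs_nonneg _) (inv_nonneg.2 hr.le)

/-- `∫ₓ b_r(x, x₀) b_r(y, x) dx ≤ 3/(πr³)` (`0 < r < 1/2`). [folklore] -/
theorem coneCone_le {r : ℝ} (hr : 0 < r) (hr2 : r < 1 / 2) (y x₀ : T3) : ∫ x, cone r x x₀ * cone r y x ≤ 3 / (Real.pi * r ^ 3) := by
  have h1 : ∫ x, cone r y x = 1 := integral_cone_eq_one hr hr2 y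
  calc ∫ x, cone r x x₀ * cone r y x ≤ ∫ x, 3 / (Real.pi * r ^ 3) * cone r y x := by
        refine integral_mono_of_nonneg (ae_of_all _ fun x => mul_nonneg (cone_nonneg hr _ _) (cone_nonneg hr _ _))
          ((integrable_of_continuous_T3 (continuous_cone r y)).const_mul _) (ae_of_all _ fun x => ?_)
        exact mul_le_mul_of_nonneg_right ((le_abs_self _).trans (L.abs_cone_le hr _ _)) (cone_nonneg hr _ _)
    _ = 3 / (Real.pi * r ^ 3) := by rw [integral_const_mul, h1, mul_one]

/-- **The cone-localised entropic mark integral is measurable in the window centre** (`h` continuous). [folklore] -/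
theorem measurable_markI (r δ K : ℝ) {h : ℝ → ℝ} (hh : Continuous h) (w : Phase N) (y : T3) (v' v : V3) :
    Measurable (markI r δ K h w y v' v) := by
  have hc1 : Measurable fun q : T3 × T3 => cone r q.2 q.1 :=
    ((continuous_cone_uncurry' r).measurable.comp (measurable_snd.prodMk measurable_fst) :)
  have hc2 : Measurable fun q : T3 × T3 => cone r y q.2 := ((continuous_cone r y).measurable.comp measurable_snd :)
  have hρ : Measurable fun q : T3 × T3 => h (rhoC r w q.2) :=
    (hh.measurable.comp ((continuous_rhoC r w).measurable.comp measurable_snd) :)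
  have hL1 : Measurable fun q : T3 × T3 => LamC r δ K w q.2 v' :=
    measurable_LamC_comp r δ K measurable_const measurable_snd measurable_const
  have hL2 : Measurable fun q : T3 × T3 => LamC r δ K w q.2 v :=
    measurable_LamC_comp r δ K measurable_const measurable_snd measurable_const
  have hF : Measurable fun q : T3 × T3 => cone r q.2 q.1 * h (rhoC r w q.2) * cone r y q.2 * (LamC r δ K w q.2 v' - LamC r δ K w q.2 v) :=
    ((hc1.mul hρ).mul hc2).mul (hL1.sub hL2)
  exact (hF.stronglyMeasurable.integral_prod_right' (ν := (volume : Measure T3))).measurable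

/-- **`Kent` is jointly measurable and bounded in the window centre** along a good orbit. [folklore] -/
theorem kentW_facts (hz : z ∈ Φ.good) (hσ : 0 < σ) {r : ℝ} (hr : 0 < r) (hr2 : r < 1 / 2) {δ : ℝ} (hδ : 0 < δ)
    (τ K : ℝ) {h : ℝ → ℝ} (hh : Continuous h) {Ch ρb : ℝ} (hCh : ∀ a, |h a| ≤ Ch) (hh0 : ∀ a, ρb ≤ a → h a = 0)
    (hρb : 0 ≤ ρb) :
    Measurable (uncurry (kentW Φ τ r δ K h z)) ∧ ∃ C : ℝ, ∀ t₀ x₀, |kentW Φ τ r δ K h z t₀ x₀| ≤ C := by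
  have hB : ∀ s i j x₀, |markI r δ K h (Φ.flow s z) (Φ.flow s z i).1 (pvel Φ z s i j).1 (Φ.flow s z i).2 x₀| ≤
      Ch * (2 * ALam K δ ρb + 2 * (‖(pvel Φ z s i j).1‖ ^ 2 + ‖(Φ.flow s z i).2‖ ^ 2)) * (3 / (Real.pi * r ^ 3)) :=
    fun s i j x₀ => (abs_markI_le hr hδ K hCh hh0 hρb (Φ.flow s z) (Φ.flow s z i).1 (pvel Φ z s i j).1
      (Φ.flow s z i).2 x₀).trans (mul_le_mul_of_nonneg_left (coneCone_le hr hr2 _ x₀) (mul_nonneg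
        ((abs_nonneg _).trans (hCh 0))
        (by nlinarith [ALam_nonneg K δ hρb, sq_nonneg ‖(pvel Φ z s i j).1‖, sq_nonneg ‖(Φ.flow s z i).2‖])))
  have hk := kwindow_facts Φ hz hσ hr τ
    (Mk := fun s i j x₀ => markI r δ K h (Φ.flow s z) (Φ.flow s z i).1 (pvel Φ z s i j).1 (Φ.flow s z i).2 x₀)
    (fun s i j => measurable_markI r δ K hh _ _ _ _)
    (B := fun s i j => Ch * (2 * ALam K δ ρb + 2 * (‖(pvel Φ z s i j).1‖ ^ 2 + ‖(Φ.flow s z i).2‖ ^ 2)) *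
      (3 / (Real.pi * r ^ 3))) hB
  exact ⟨hk.1, _, hk.2⟩

/-- **`Kr` is jointly measurable and bounded in the window centre** along a good orbit. [folklore] -/
theorem krW_facts (hz : z ∈ Φ.good) (hσ : 0 < σ) {r : ℝ} (hr : 0 < r) (hr2 : r < 1 / 2) {δ : ℝ} (hδ : 0 < δ)
    (τ K L : ℝ) {h : ℝ → ℝ} (hh : Continuous h) {Ch ρb : ℝ} (hCh : ∀ a, |h a| ≤ Ch) (hh0 : ∀ a, ρb ≤ a → h a = 0)
    (hρb : 0 ≤ ρb) :
    Measurable (uncurry (krW Φ τ r δ K L h z)) ∧ ∃ C : ℝ, ∀ t₀ x₀, |krW Φ τ r δ K L h z t₀ x₀| ≤ C := by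
  have hB : ∀ s i j x₀, |cutL L (pvel Φ z s i j).1 (pvel Φ z s i j).2 *
      markI r δ K h (Φ.flow s z) (Φ.flow s z i).1 (pvel Φ z s i j).1 (Φ.flow s z i).2 x₀| ≤
      Ch * (2 * ALam K δ ρb + 2 * (‖(pvel Φ z s i j).1‖ ^ 2 + ‖(Φ.flow s z i).2‖ ^ 2)) * (3 / (Real.pi * r ^ 3)) := by
    intro s i j x₀
    have hc := cutL_nonneg_le L (pvel Φ z s i j).1 (pvel Φ z s i j).2
    have hm := (abs_markI_le hr hδ K hCh hh0 hρb (Φ.flow s z) (Φ.flow s z i).1 (pvel Φ z s i j).1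
      (Φ.flow s z i).2 x₀).trans (mul_le_mul_of_nonneg_left (coneCone_le hr hr2 (Φ.flow s z i).1 x₀) (mul_nonneg
        ((abs_nonneg _).trans (hCh 0))
        (by nlinarith [ALam_nonneg K δ hρb, sq_nonneg ‖(pvel Φ z s i j).1‖, sq_nonneg ‖(Φ.flow s z i).2‖])))
    rw [abs_mul, abs_of_nonneg hc.1]
    exact (mul_le_of_le_one_left (abs_nonneg _) hc.2).trans hm
  have hk := kwindow_facts Φ hz hσ hr τ
    (Mk := fun s i j x₀ => cutL L (pvel Φ z s i j).1 (pvel Φ z s i j).2 *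
      markI r δ K h (Φ.flow s z) (Φ.flow s z i).1 (pvel Φ z s i j).1 (Φ.flow s z i).2 x₀)
    (fun s i j => (measurable_markI r δ K hh _ _ _ _).const_mul _)
    (B := fun s i j => Ch * (2 * ALam K δ ρb + 2 * (‖(pvel Φ z s i j).1‖ ^ 2 + ‖(Φ.flow s z i).2‖ ^ 2)) *
      (3 / (Real.pi * r ^ 3))) hB
  have he : (uncurry fun (t₀ : ℝ) (x₀ : T3) => csum Φ τ (fun s i j => r⁻¹ * max (1 - |s - t₀| / r) 0 *
      (cutL L (pvel Φ z s i j).1 (pvel Φ z s i j).2 *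
        markI r δ K h (Φ.flow s z) (Φ.flow s z i).1 (pvel Φ z s i j).1 (Φ.flow s z i).2 x₀)) z) =
      uncurry (krW Φ τ r δ K L h z) := by
    funext q; simp only [uncurry, krW, mul_assoc]
  have hb : ∀ t₀ x₀, |krW Φ τ r δ K L h z t₀ x₀| ≤ csum Φ τ (fun s i j => r⁻¹ *
      (Ch * (2 * ALam K δ ρb + 2 * (‖(pvel Φ z s i j).1‖ ^ 2 + ‖(Φ.flow s z i).2‖ ^ 2)) * (3 / (Real.pi * r ^ 3)))) z := by
    intro t₀ x₀
    have h2 := hk.2 t₀ x₀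
    simp only [mul_assoc] at h2
    unfold krW
    simp only [mul_assoc]
    exact h2
  exact ⟨he ▸ hk.1, _, hb⟩

/-! ## §4 Integrability of the pointwise-entropic-chaos integrand -/

/-- **The pointwise-entropic-chaos integrand `|Kr − R|` is integrable**: its `x₀`-slices are integrable and its space
integral is integrable on every time window (bounded, jointly measurable). [folklore] -/
theorem integrable_krW_sub_rW (hz : z ∈ Φ.good) (hσ : 0 < σ) {r : ℝ} (hr : 0 < r) (hr2 : r < 1 / 2) {δ : ℝ}
    (hδ : 0 < δ) (τ K L : ℝ) {h Y : ℝ → ℝ} (hh : Continuous h) (hY : Measurable Y) {Ch CY ρb : ℝ}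
    (hCh : ∀ a, |h a| ≤ Ch) (hhY : ∀ a, |h a * Y (σ ^ 3 * a)| ≤ CY) (hh0 : ∀ a, ρb ≤ a → h a = 0) (hρb : 0 ≤ ρb) :
    Measurable (uncurry fun t₀ x₀ => |krW Φ τ r δ K L h z t₀ x₀ - rW Φ σ τ r δ K L h Y z t₀ x₀|) ∧
    (∃ C : ℝ, ∀ t₀ x₀, |(|krW Φ τ r δ K L h z t₀ x₀ - rW Φ σ τ r δ K L h Y z t₀ x₀|)| ≤ C) ∧
    (∀ t₀, Integrable (fun x₀ => |krW Φ τ r δ K L h z t₀ x₀ - rW Φ σ τ r δ K L h Y z t₀ x₀|) (volume : Measure T3)) ∧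
    (∀ lo hi, IntegrableOn (fun t₀ => ∫ x₀, |krW Φ τ r δ K L h z t₀ x₀ - rW Φ σ τ r δ K L h Y z t₀ x₀|)
      (Set.Icc lo hi) volume) := by
  obtain ⟨hKm, CK, hKb⟩ := krW_facts Φ hz hσ hr hr2 hδ τ K L hh hCh hh0 hρb
  have hRm := measurable_rW Φ hz hr hδ σ τ K L hh hY hhY hh0 hρb
  have hRb := abs_rW_le Φ hr hr2 hδ hσ.le τ K L hhY hh0 hρb z
  have hm : Measurable (uncurry fun t₀ x₀ => |krW Φ τ r δ K L h z t₀ x₀ - rW Φ σ τ r δ K L h Y z t₀ x₀|) :=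
    (hKm.sub hRm).abs
  have hb : ∀ t₀ x₀, |(|krW Φ τ r δ K L h z t₀ x₀ - rW Φ σ τ r δ K L h Y z t₀ x₀|)| ≤
      CK + σ ^ 3 * (CY * predBound L (ALam K δ ρb + 2 * max L 0)) := fun t₀ x₀ => by
    rw [abs_abs]; exact (abs_sub _ _).trans (add_le_add (hKb t₀ x₀) (hRb t₀ x₀))
  exact ⟨hm, ⟨_, hb⟩, fun t₀ => integrable_slice hm hb t₀, fun lo hi => integrableOn_integral_slice hm hb lo hi⟩

end Orbit

/-! ## §5 Registered sub-goal -/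

/-- **Registered sub-goal `stub_localEquilibriumFromDissipationE` (helper E of `stub_localEquilibriumFromDissipation`):
the cone–cone kernel is bounded by the height of the cone** — `∫ₓ b_r(x, x₀) b_r(y, x) dx ≤ 3/(πr³)` for
`0 < r < 1/2`. [folklore] -/
theorem stub_localEquilibriumFromDissipationE : ∀ {r : ℝ}, 0 < r → r < 1 / 2 → ∀ (y x₀ : T3), ∫ x : T3, cone r x x₀ * cone r y x ≤ 3 / (Real.pi * r ^ 3) :=
  fun hr hr2 y x₀ => coneCone_le hr hr2 y x₀

end Summit.AtomisticToContinuum.HydrodynamicLimit.Theorems.ChaosClosesEulerLocalEquilibriumFromDissipation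

end
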